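import Summits.CriticalPhenomena.PercolationContinuityZ3.Theorems.SahiLiebSahiContinuumProduct
import Mathlib.Probability.Kernel.Composition.MeasureCompProd

/-!
# The standard construction in the continuum: stochastically increasing kernels, CIS laws on the unit square

Companion of `SahiLiebSahiContinuumProduct.lean` (cell `prim-sahi`, typer, generation 9; `--supports
stmt-CriticalPhenomena-4575`).

`SahiLiebSahiContinuumProduct.lean` shows that Lieb–Sahi's continuous case `LiebSahiContinuum d n` (`E_n ≥ 0` for
positive monotone functions on `Q_d = [0,1]^d`, LEBESGUE measure) controls every MONOTONE MEASURABLE IMAGE of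
Lebesgue measure, and that product measures are such images (coordinatewise quantile transform).  Here the class
of monotone images is closed under one more operation — the continuum form of the sequential ("standard",
Rosenblatt) construction whose discrete form is the tree's `Sahi2008/SequentialCoupling.lean`:

* `KernelQuantile.kq κ (a, v) = inf {t : v ≤ κ_a([0,t])}` — the quantile transform of a Markov kernel
  `κ : α → [0,1]`, taken fibrewise.  It is JOINTLY measurable (`KernelQuantile.measurable_kq`, from the Galois
  property `q_{κ a}(v) ≤ x ↔ v ≤ κ_a([0,x])`), pushes `μ ⊗ λ` forward to the composition-product `μ ⊗ₘ κ`
  (`KernelQuantile.map_prod_kq`), and is MONOTONE in `(a, v)` as soon as `κ` is stochastically increasing,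
  `a ≤ b ⇒ κ_b([0,x]) ≤ κ_a([0,x])` (`KernelQuantile.monotone_kq`).
* `exists_monotone_map_compProd` — hence if `μ = G_* λ_d` for a monotone measurable `G : Q_d → α` and `κ` is a
  stochastically increasing Markov kernel `α → [0,1]`, then `μ ⊗ₘ κ = G'_* λ_{d+1}` for a monotone measurable
  `G' : Q_{d+1} → α × [0,1]`; so `LiebSahiContinuum (d+1) n ⇒ E_n ≥ 0` under `μ ⊗ₘ κ` for all nonnegative
  monotone measurable families on `α × [0,1]` (`msahiE_compProd_nonneg_of_liebSahiContinuum(_antitone)`).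
* UNCONDITIONALLY (`d + 1 = 2`, Lieb–Sahi's Theorem 3.7): **every conditionally increasing law on the unit
  square is Sahi-positive of every order** — for every probability measure `μ₁` on `[0,1]` and every
  stochastically increasing Markov kernel `κ : [0,1] → [0,1]`, all nonnegative monotone (increasing, resp.
  decreasing) measurable `f_0,…,f_{n−1} : [0,1]² → ℝ` have `E_n(f_0,…,f_{n−1}) ≥ 0` under `μ₁ ⊗ₘ κ`
  (`msahiE_compProd_unitSquare_nonneg(_antitone)`); equivalently for every probability measure `μ` on `[0,1]²`
  admitting a stochastically increasing disintegration `μ = μ.fst ⊗ₘ κ` (`msahiE_nonneg_of_cis_unitSquare`).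
  This contains the product measures `μ₁ ⊗ μ₂` (constant kernel; `msahiE_prod_nonneg_of_monotone`) and is the
  natural home of the absolutely continuous MTP₂/FKG densities of `SahiTwoDimDensity(AC).lean` (a TP₂ kernel
  density is stochastically increasing) — but it needs no density: `κ_x` may be singular or atomic.
* `liebSahiContinuum_succ_iff_compProd` — conversely Lebesgue measure `λ_{d+1}` is `λ_d ⊗ₘ (const λ)`, so
  `LiebSahiContinuum (d+1) n` is EQUIVALENT to `E_n ≥ 0` under every `(G_* λ_d) ⊗ₘ κ` as above.

Nothing here asserts `LiebSahiContinuum d n` for `d ≥ 3`.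
-/

noncomputable section

namespace Summit.CriticalPhenomena.PercolationContinuityZ3.Theorems

open MeasureTheory ProbabilityTheory Set Filter Topology Literature.Combinatorics.Sahi2008
open scoped unitInterval

/-! ### Stochastic order and the quantile transform on `[0,1]` -/

namespace UnitIntervalQuantile

/-- **Stochastic monotonicity of the quantile transform**: if `ν([0,x]) ≤ μ([0,x])` for all `x` (`ν` is
stochastically larger than `μ`), then `q_μ(u) ≤ q_ν(u)` for every `u`. [folklore] -/
theorem quantile_mono_measure (μ ν : Measure I) [IsProbabilityMeasure μ] [IsProbabilityMeasure ν]
    (h : ∀ x : I, ν (Set.Iic x) ≤ μ (Set.Iic x)) (u : I) : quantile μ u ≤ quantile ν u := by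
  rw [quantile_le_iff]
  calc (u : ℝ) ≤ cdf ν (quantile ν u) := le_cdf_quantile ν u
    _ ≤ cdf μ (quantile ν u) := by
      rw [cdf_coe, cdf_coe]
      exact ENNReal.toReal_mono (measure_ne_top _ _) (h _)

end UnitIntervalQuantile

/-! ### The quantile transform of a Markov kernel `α → [0,1]` -/

namespace KernelQuantile

variable {α : Type*} [MeasurableSpace α] (κ : Kernel α I) [IsMarkovKernel κ]

/-- **The kernel quantile transform** `(a, v) ↦ q_{κ a}(v) = inf {t : v ≤ κ_a([0,t])}` of a Markov kernel
`κ : α → [0,1]` (the quantile transform of `SahiLiebSahiContinuumProduct.lean`, fibrewise). [folklore] -/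
def kq (p : α × I) : I := UnitIntervalQuantile.quantile (κ p.1) p.2

/-- The value of the kernel quantile transform. [folklore] -/
theorem kq_apply (a : α) (v : I) : kq κ (a, v) = UnitIntervalQuantile.quantile (κ a) v := rfl

/-- **Galois property**: `q_{κ a}(v) ≤ x ↔ v ≤ κ_a([0,x])`. [folklore] -/
theorem kq_le_iff (p : α × I) (x : I) : kq κ p ≤ x ↔ (p.2 : ℝ) ≤ (κ p.1).real (Set.Iic x) := by
  rw [kq, UnitIntervalQuantile.quantile_le_iff, UnitIntervalQuantile.cdf_coe]

/-- **The kernel quantile transform is jointly measurable** (its sublevel sets `{q ≤ x} = {(a,v) : v ≤ κ_a([0,x])}`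
are measurable because `a ↦ κ_a([0,x])` is). [folklore] -/
theorem measurable_kq : Measurable (kq κ) := by
  refine measurable_of_Iic fun x => ?_
  have hset : kq κ ⁻¹' Set.Iic x = {p : α × I | (p.2 : ℝ) ≤ (κ p.1).real (Set.Iic x)} := by
    ext p
    rw [Set.mem_preimage, Set.mem_Iic, kq_le_iff]
    rfl
  rw [hset]
  refine measurableSet_le (measurable_subtype_coe.comp measurable_snd) ?_
  exact ((Kernel.measurable_coe κ measurableSet_Iic).comp measurable_fst).ennreal_toReal

/-- On each fibre the kernel quantile transform pushes Lebesgue measure of `[0,1]` to `κ a`. [folklore] -/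
theorem map_kq_mk (a : α) : (volume : Measure I).map (fun v => kq κ (a, v)) = κ a :=
  UnitIntervalQuantile.map_quantile_volume (κ a)

/-- The fibre maps are measurable. [folklore] -/
theorem measurable_kq_mk (a : α) : Measurable fun v => kq κ (a, v) :=
  UnitIntervalQuantile.measurable_quantile (κ a)

/-- **The standard construction realises the composition-product**: `(a, v) ↦ (a, q_{κ a}(v))` pushes `μ ⊗ λ`
forward to `μ ⊗ₘ κ` (both give `∫ κ_a(S_a) dμ(a)` to a measurable `S`). [folklore] -/
theorem map_prod_kq (μ : Measure α) [SFinite μ] :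
    (μ.prod (volume : Measure I)).map (fun p : α × I => (p.1, kq κ p)) = μ ⊗ₘ κ := by
  have hm : Measurable fun p : α × I => (p.1, kq κ p) := measurable_fst.prodMk (measurable_kq κ)
  ext s hs
  rw [Measure.map_apply hm hs, Measure.prod_apply (hm hs), Measure.compProd_apply hs]
  refine lintegral_congr fun a => ?_
  have hfib : Prod.mk a ⁻¹' ((fun p : α × I => (p.1, kq κ p)) ⁻¹' s) =
      (fun v => kq κ (a, v)) ⁻¹' (Prod.mk a ⁻¹' s) := rfl
  rw [hfib, ← Measure.map_apply (measurable_kq_mk κ a) (hs.preimage measurable_prodMk_left), map_kq_mk]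

variable [Preorder α]

/-- **Monotonicity**: if `κ` is stochastically increasing (`a ≤ b ⇒ κ_b([0,x]) ≤ κ_a([0,x])` for all `x`), the
kernel quantile transform is monotone in `(a, v)` for the product order. [folklore] -/
theorem monotone_kq (hκ : ∀ ⦃a b : α⦄, a ≤ b → ∀ x : I, κ b (Set.Iic x) ≤ κ a (Set.Iic x)) :
    Monotone (kq κ) := by
  rintro ⟨a, u⟩ ⟨b, v⟩ ⟨hab, huv⟩
  exact (UnitIntervalQuantile.quantile_mono (κ a) huv).trans
    (UnitIntervalQuantile.quantile_mono_measure (κ a) (κ b) (hκ hab) v)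

/-- The graph map `(a, v) ↦ (a, q_{κ a}(v))` is monotone for a stochastically increasing kernel. [folklore] -/
theorem monotone_mk_kq (hκ : ∀ ⦃a b : α⦄, a ≤ b → ∀ x : I, κ b (Set.Iic x) ≤ κ a (Set.Iic x)) :
    Monotone fun p : α × I => (p.1, kq κ p) :=
  fun _ _ hpq => ⟨hpq.1, monotone_kq κ hκ hpq⟩

end KernelQuantile

/-! ### Monotone images of Lebesgue measure are closed under stochastically increasing kernels -/

variable {d n : ℕ}

/-- Splitting off the last coordinate, `Q_{d+1} ≃ [0,1] × Q_d`, is monotone (plumbing). [folklore] -/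
private theorem monotone_piFinSuccAbove_last :
    Monotone (MeasurableEquiv.piFinSuccAbove (fun _ : Fin (d + 1) => I) (Fin.last d)) := by
  intro x y hxy
  change (x (Fin.last d), Fin.removeNth (Fin.last d) x) ≤ (y (Fin.last d), Fin.removeNth (Fin.last d) y)
  exact ⟨hxy _, fun j => hxy _⟩

/-- **The standard construction, one step**: if `μ = G_* λ_d` for a monotone measurable `G : Q_d → α` into a
measurable preorder and `κ : α → [0,1]` is a stochastically increasing Markov kernel, then the
composition-product `μ ⊗ₘ κ` on `α × [0,1]` is again the image of Lebesgue measure `λ_{d+1}` on `Q_{d+1}` under a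
monotone measurable map (namely `x ↦ (G(x'), q_{κ (G x')}(x_d))`, `x' = (x_0,…,x_{d−1})`). [this work] -/
theorem exists_monotone_map_compProd {α : Type*} [MeasurableSpace α] [Preorder α] {G : (Fin d → I) → α}
    (hGm : Measurable G) (hG : Monotone G) (κ : Kernel α I) [IsMarkovKernel κ]
    (hκ : ∀ ⦃a b : α⦄, a ≤ b → ∀ x : I, κ b (Set.Iic x) ≤ κ a (Set.Iic x)) :
    ∃ G' : (Fin (d + 1) → I) → α × I, Measurable G' ∧ Monotone G' ∧
      (volume : Measure (Fin (d + 1) → I)).map G' = ((volume : Measure (Fin d → I)).map G) ⊗ₘ κ := by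
  -- `Q_{d+1} ≃ [0,1] × Q_d`, then swap, then `G × id`, then the graph of the kernel quantile transform
  set e := MeasurableEquiv.piFinSuccAbove (fun _ : Fin (d + 1) => I) (Fin.last d) with he
  set Ψ : I × (Fin d → I) → α × I := fun q => (G q.2, KernelQuantile.kq κ (G q.2, q.1)) with hΨ
  have hstep : Measurable fun p : α × I => (p.1, KernelQuantile.kq κ p) :=
    measurable_fst.prodMk (KernelQuantile.measurable_kq κ)
  have hGid : Measurable (Prod.map G (id : I → I)) := hGm.prodMap measurable_id
  have hΨeq : Ψ = ((fun p : α × I => (p.1, KernelQuantile.kq κ p)) ∘ Prod.map G id) ∘ Prod.swap := by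
    funext q; rfl
  have hΨm : Measurable Ψ := by
    rw [hΨeq]; exact (hstep.comp hGid).comp measurable_swap
  refine ⟨Ψ ∘ e, hΨm.comp e.measurable, ?_, ?_⟩
  · intro x y hxy
    have hexy := monotone_piFinSuccAbove_last (d := d) hxy
    refine ⟨hG hexy.2, KernelQuantile.monotone_kq κ hκ (a := (G (e x).2, (e x).1))
      (b := (G (e y).2, (e y).1)) ⟨hG hexy.2, hexy.1⟩⟩
  · have hev : (volume : Measure (Fin (d + 1) → I)).map e = (volume : Measure I).prod volume :=
      (volume_preserving_piFinSuccAbove (fun _ : Fin (d + 1) => I) (Fin.last d)).map_eq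
    rw [← Measure.map_map hΨm e.measurable, hev, hΨeq, ← Measure.map_map (hstep.comp hGid) measurable_swap,
      Measure.prod_swap, ← Measure.map_map hstep hGid, ← Measure.map_prod_map _ _ hGm measurable_id,
      Measure.map_id, KernelQuantile.map_prod_kq]

/-- **`LiebSahiContinuum (d+1) n` controls every composition-product of a monotone image of `λ_d` with a
stochastically increasing kernel** (increasing measurable families on `α × [0,1]`, product order). [this work] -/
theorem msahiE_compProd_nonneg_of_liebSahiContinuum (h : LiebSahiContinuum (d + 1) n) {α : Type*}
    [MeasurableSpace α] [Preorder α] {G : (Fin d → I) → α} (hGm : Measurable G) (hG : Monotone G)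
    (κ : Kernel α I) [IsMarkovKernel κ] (hκ : ∀ ⦃a b : α⦄, a ≤ b → ∀ x : I, κ b (Set.Iic x) ≤ κ a (Set.Iic x))
    (f : Fin n → α × I → ℝ) (hfm : ∀ i, Measurable (f i)) (hf0 : ∀ i p, 0 ≤ f i p)
    (hmono : ∀ i, Monotone (f i)) : 0 ≤ msahiE (((volume : Measure (Fin d → I)).map G) ⊗ₘ κ) n f := by
  obtain ⟨G', hG'm, hG'mono, hG'eq⟩ := exists_monotone_map_compProd hGm hG κ hκ
  rw [← hG'eq]
  exact msahiE_map_nonneg_of_liebSahiContinuum h hG'm hG'mono f hfm hf0 hmono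

/-- The same for DECREASING measurable families. [this work] -/
theorem msahiE_compProd_nonneg_of_liebSahiContinuum_antitone (h : LiebSahiContinuum (d + 1) n) {α : Type*}
    [MeasurableSpace α] [Preorder α] {G : (Fin d → I) → α} (hGm : Measurable G) (hG : Monotone G)
    (κ : Kernel α I) [IsMarkovKernel κ] (hκ : ∀ ⦃a b : α⦄, a ≤ b → ∀ x : I, κ b (Set.Iic x) ≤ κ a (Set.Iic x))
    (f : Fin n → α × I → ℝ) (hfm : ∀ i, Measurable (f i)) (hf0 : ∀ i p, 0 ≤ f i p)
    (hanti : ∀ i, Antitone (f i)) : 0 ≤ msahiE (((volume : Measure (Fin d → I)).map G) ⊗ₘ κ) n f := by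
  obtain ⟨G', hG'm, hG'mono, hG'eq⟩ := exists_monotone_map_compProd hGm hG κ hκ
  rw [← hG'eq]
  exact msahiE_map_nonneg_of_liebSahiContinuum_antitone h hG'm hG'mono f hfm hf0 hanti

/-! ### Unconditionally: conditionally increasing (CIS) laws on the unit square -/

/-- **The standard construction on the unit square**: for a probability measure `μ₁` on `[0,1]` and a
stochastically increasing Markov kernel `κ : [0,1] → [0,1]`, the law `μ₁ ⊗ₘ κ` is the image of Lebesgue measure
on `Q_2` under the monotone measurable map `(u, v) ↦ (q_{μ₁}(u), q_{κ(q_{μ₁} u)}(v))`. [this work] -/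
theorem exists_monotone_map_compProd_unitSquare (μ₁ : Measure I) [IsProbabilityMeasure μ₁] (κ : Kernel I I)
    [IsMarkovKernel κ] (hκ : ∀ ⦃a b : I⦄, a ≤ b → ∀ x : I, κ b (Set.Iic x) ≤ κ a (Set.Iic x)) :
    ∃ G' : (Fin 2 → I) → I × I, Measurable G' ∧ Monotone G' ∧
      (volume : Measure (Fin 2 → I)).map G' = μ₁ ⊗ₘ κ := by
  -- `μ₁ = q_* λ_1` along `Q_1 ≃ [0,1]`
  set G : (Fin 1 → I) → I := fun u => UnitIntervalQuantile.quantile μ₁ (u 0) with hG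
  have hGm : Measurable G :=
    (UnitIntervalQuantile.measurable_quantile μ₁).comp (measurable_pi_apply 0)
  have hGmono : Monotone G := fun u v huv => UnitIntervalQuantile.quantile_mono μ₁ (huv 0)
  have hGeq : (volume : Measure (Fin 1 → I)).map G = μ₁ := by
    have h1 : MeasurePreserving (MeasurableEquiv.funUnique (Fin 1) I) (volume : Measure (Fin 1 → I))
        volume := volume_preserving_funUnique (Fin 1) I
    have h2 := (UnitIntervalQuantile.measurePreserving_quantile μ₁).comp h1
    exact h2.map_eq
  obtain ⟨G', hG'm, hG'mono, hG'eq⟩ := exists_monotone_map_compProd hGm hGmono κ hκ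
  exact ⟨G', hG'm, hG'mono, by rw [hG'eq, hGeq]⟩

/-- **Every conditionally increasing law on the unit square is Sahi-positive of every order** (increasing
form): for every probability measure `μ₁` on `[0,1]`, every stochastically increasing Markov kernel
`κ : [0,1] → [0,1]` (`a ≤ b ⇒ κ_b([0,x]) ≤ κ_a([0,x])`), every `n`, and all nonnegative monotone increasing
measurable `f_0,…,f_{n−1} : [0,1]² → ℝ`: `E_n(f_0,…,f_{n−1}) ≥ 0` under `μ₁ ⊗ₘ κ`.  UNCONDITIONAL (Lieb–Sahi's
Theorem 3.7 transported along the standard construction); contains every product measure (constant kernel) and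
needs no density. [this work] -/
theorem msahiE_compProd_unitSquare_nonneg (μ₁ : Measure I) [IsProbabilityMeasure μ₁] (κ : Kernel I I)
    [IsMarkovKernel κ] (hκ : ∀ ⦃a b : I⦄, a ≤ b → ∀ x : I, κ b (Set.Iic x) ≤ κ a (Set.Iic x)) (n : ℕ)
    (f : Fin n → I × I → ℝ) (hfm : ∀ i, Measurable (f i)) (hf0 : ∀ i p, 0 ≤ f i p)
    (hmono : ∀ i, Monotone (f i)) : 0 ≤ msahiE (μ₁ ⊗ₘ κ) n f := by
  obtain ⟨G', hG'm, hG'mono, hG'eq⟩ := exists_monotone_map_compProd_unitSquare μ₁ κ hκ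
  rw [← hG'eq]
  exact msahiE_map_unitSquare_nonneg hG'm hG'mono n f hfm hf0 hmono

/-- **Every conditionally increasing law on the unit square, printed (decreasing) form**: nonnegative monotone
decreasing measurable families have `E_n ≥ 0` under `μ₁ ⊗ₘ κ`. [this work] -/
theorem msahiE_compProd_unitSquare_nonneg_antitone (μ₁ : Measure I) [IsProbabilityMeasure μ₁]
    (κ : Kernel I I) [IsMarkovKernel κ]
    (hκ : ∀ ⦃a b : I⦄, a ≤ b → ∀ x : I, κ b (Set.Iic x) ≤ κ a (Set.Iic x)) (n : ℕ)
    (f : Fin n → I × I → ℝ) (hfm : ∀ i, Measurable (f i)) (hf0 : ∀ i p, 0 ≤ f i p)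
    (hanti : ∀ i, Antitone (f i)) : 0 ≤ msahiE (μ₁ ⊗ₘ κ) n f := by
  obtain ⟨G', hG'm, hG'mono, hG'eq⟩ := exists_monotone_map_compProd_unitSquare μ₁ κ hκ
  rw [← hG'eq]
  exact msahiE_map_nonneg_of_liebSahiContinuum_antitone (liebSahiContinuum_two n) hG'm hG'mono f hfm hf0
    hanti

/-- **CIS laws, disintegrated form**: a probability measure `μ` on `[0,1]²` admitting a stochastically increasing
disintegration `μ = μ.fst ⊗ₘ κ` (a monotone version of its conditional law of the second coordinate given the
first) is Sahi-positive of every order for measurable increasing families. [this work] -/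
theorem msahiE_nonneg_of_cis_unitSquare (μ : Measure (I × I)) [IsProbabilityMeasure μ] (κ : Kernel I I)
    [IsMarkovKernel κ] (hdis : μ.fst ⊗ₘ κ = μ)
    (hκ : ∀ ⦃a b : I⦄, a ≤ b → ∀ x : I, κ b (Set.Iic x) ≤ κ a (Set.Iic x)) (n : ℕ)
    (f : Fin n → I × I → ℝ) (hfm : ∀ i, Measurable (f i)) (hf0 : ∀ i p, 0 ≤ f i p)
    (hmono : ∀ i, Monotone (f i)) : 0 ≤ msahiE μ n f := by
  rw [← hdis]
  exact msahiE_compProd_unitSquare_nonneg μ.fst κ hκ n f hfm hf0 hmono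

/-- The decreasing form of `msahiE_nonneg_of_cis_unitSquare`. [this work] -/
theorem msahiE_nonneg_of_cis_unitSquare_antitone (μ : Measure (I × I)) [IsProbabilityMeasure μ]
    (κ : Kernel I I) [IsMarkovKernel κ] (hdis : μ.fst ⊗ₘ κ = μ)
    (hκ : ∀ ⦃a b : I⦄, a ≤ b → ∀ x : I, κ b (Set.Iic x) ≤ κ a (Set.Iic x)) (n : ℕ)
    (f : Fin n → I × I → ℝ) (hfm : ∀ i, Measurable (f i)) (hf0 : ∀ i p, 0 ≤ f i p)
    (hanti : ∀ i, Antitone (f i)) : 0 ≤ msahiE μ n f := by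
  rw [← hdis]
  exact msahiE_compProd_unitSquare_nonneg_antitone μ.fst κ hκ n f hfm hf0 hanti

/-- Consistency: with the CONSTANT kernel `κ ≡ μ₂` (trivially stochastically increasing) the composition-product
is the product measure, so `msahiE_compProd_unitSquare_nonneg` contains `msahiE_prod_nonneg_of_monotone`. -/
example (μ₁ μ₂ : Measure I) [IsProbabilityMeasure μ₁] [IsProbabilityMeasure μ₂] (n : ℕ)
    (f : Fin n → I × I → ℝ) (hfm : ∀ i, Measurable (f i)) (hf0 : ∀ i p, 0 ≤ f i p)
    (hmono : ∀ i, Monotone (f i)) : 0 ≤ msahiE (μ₁.prod μ₂) n f := by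
  rw [← Measure.compProd_const]
  exact msahiE_compProd_unitSquare_nonneg μ₁ (Kernel.const I μ₂) (fun a b _ x => le_rfl) n f hfm hf0 hmono

/-! ### The continuous case in dimension `d + 1` is a statement about composition-products -/

/-- The splitting `Q_{d+1} ≃ [0,1] × Q_d` reflects the order (plumbing). [folklore] -/
private theorem le_of_piFinSuccAbove_last_le {x y : Fin (d + 1) → I}
    (h : MeasurableEquiv.piFinSuccAbove (fun _ : Fin (d + 1) => I) (Fin.last d) x ≤
      MeasurableEquiv.piFinSuccAbove (fun _ : Fin (d + 1) => I) (Fin.last d) y) : x ≤ y := by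
  change (x (Fin.last d), Fin.removeNth (Fin.last d) x) ≤ (y (Fin.last d), Fin.removeNth (Fin.last d) y) at h
  intro j
  rcases Fin.eq_castSucc_or_eq_last j with ⟨k, rfl⟩ | rfl
  · have hk := h.2 k
    change x ((Fin.last d).succAbove k) ≤ y ((Fin.last d).succAbove k) at hk
    rwa [Fin.succAbove_last] at hk
  · exact h.1

/-- **`LiebSahiContinuum (d+1) n` ⟺ Sahi positivity of every `λ_d ⊗ₘ κ`, `κ : Q_d → [0,1]` a stochastically
increasing Markov kernel** (measurable increasing families on `Q_d × [0,1]`).  `⇒` is the standard construction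
(`msahiE_compProd_nonneg_of_liebSahiContinuum` with `G = id`); `⇐` takes the constant kernel `κ ≡ λ`
(`λ_d ⊗ₘ λ = λ_d ⊗ λ ≅ λ_{d+1}`) and removes measurability by `LebesgueCube.mSahiPositive_volume_of_measurable`.
Combined with `exists_monotone_map_compProd` the right-hand side may equivalently range over all
`(G_* λ_d) ⊗ₘ κ`, `G` monotone measurable into any measurable preorder. [this work] -/
theorem liebSahiContinuum_succ_iff_compProd :
    LiebSahiContinuum (d + 1) n ↔
      ∀ (κ : Kernel (Fin d → I) I) [IsMarkovKernel κ],
        (∀ ⦃a b : Fin d → I⦄, a ≤ b → ∀ x : I, κ b (Set.Iic x) ≤ κ a (Set.Iic x)) →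
          ∀ f : Fin n → (Fin d → I) × I → ℝ, (∀ i, Measurable (f i)) → (∀ i p, 0 ≤ f i p) →
            (∀ i, Monotone (f i)) → 0 ≤ msahiE ((volume : Measure (Fin d → I)) ⊗ₘ κ) n f := by
  constructor
  · intro h κ _ hκ f hfm hf0 hmono
    have key := msahiE_compProd_nonneg_of_liebSahiContinuum h measurable_id monotone_id κ hκ f hfm hf0 hmono
    rwa [Measure.map_id] at key
  · intro h
    set e := MeasurableEquiv.piFinSuccAbove (fun _ : Fin (d + 1) => I) (Fin.last d) with he_def
    have he : MeasurePreserving e.symm ((volume : Measure I).prod (volume : Measure (Fin d → I))) volume :=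
      (volume_preserving_piFinSuccAbove (fun _ : Fin (d + 1) => I) (Fin.last d)).symm e
    have hswap : MeasurePreserving (Prod.swap : (Fin d → I) × I → I × (Fin d → I))
        ((volume : Measure (Fin d → I)).prod (volume : Measure I)) ((volume : Measure I).prod volume) :=
      Measure.measurePreserving_swap
    have hmeas : ∀ f : Fin n → (Fin (d + 1) → I) → ℝ, (∀ i, Measurable (f i)) → (∀ i x, 0 ≤ f i x) →
        (∀ i, Monotone (f i)) → 0 ≤ msahiE (volume : Measure (Fin (d + 1) → I)) n f := by
      intro f hfm hf0 hmono
      rw [← msahiE_comp_measurePreserving he e.symm.measurableEmbedding n f,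
        ← msahiE_comp_measurePreserving hswap
          (MeasurableEquiv.prodComm : (Fin d → I) × I ≃ᵐ I × (Fin d → I)).measurableEmbedding n _]
      have key := h (Kernel.const (Fin d → I) (volume : Measure I)) (fun a b _ x => le_rfl)
        (fun i => (f i ∘ e.symm) ∘ Prod.swap)
        (fun i => ((hfm i).comp e.symm.measurable).comp measurable_swap) (fun i p => hf0 i _)
        (fun i p q hpq => hmono i
          (le_of_piFinSuccAbove_last_le (d := d) (by
            rw [e.apply_symm_apply, e.apply_symm_apply]
            exact ⟨hpq.2, hpq.1⟩)))
      rwa [Measure.compProd_const] at key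
    exact liebSahiContinuum_iff_mSahiPositive.2 (LebesgueCube.mSahiPositive_volume_of_measurable hmeas)

end Summit.CriticalPhenomena.PercolationContinuityZ3.Theorems

/-! ### Iterating the construction: conditionally increasing laws in dimension three (appended, typer gen 9) -/

namespace Summit.CriticalPhenomena.PercolationContinuityZ3.Theorems

open MeasureTheory ProbabilityTheory Set Literature.Combinatorics.Sahi2008
open scoped unitInterval

/-- **The standard construction, two steps**: for a probability measure `μ₁` on `[0,1]`, a stochastically increasing
Markov kernel `κ₂ : [0,1] → [0,1]` and a stochastically increasing (for the product order on `[0,1]²`) Markov kernel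
`κ₃ : [0,1]² → [0,1]`, the conditionally-increasing-in-sequence law `(μ₁ ⊗ₘ κ₂) ⊗ₘ κ₃` on `[0,1]² × [0,1]` is the
image of Lebesgue measure on `Q_3` under a monotone measurable map. [this work] -/
theorem exists_monotone_map_compProd_compProd (μ₁ : Measure I) [IsProbabilityMeasure μ₁] (κ₂ : Kernel I I)
    [IsMarkovKernel κ₂] (hκ₂ : ∀ ⦃a b : I⦄, a ≤ b → ∀ x : I, κ₂ b (Set.Iic x) ≤ κ₂ a (Set.Iic x))
    (κ₃ : Kernel (I × I) I) [IsMarkovKernel κ₃]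
    (hκ₃ : ∀ ⦃p q : I × I⦄, p ≤ q → ∀ x : I, κ₃ q (Set.Iic x) ≤ κ₃ p (Set.Iic x)) :
    ∃ G' : (Fin 3 → I) → (I × I) × I, Measurable G' ∧ Monotone G' ∧
      (volume : Measure (Fin 3 → I)).map G' = (μ₁ ⊗ₘ κ₂) ⊗ₘ κ₃ := by
  obtain ⟨G₂, hG₂m, hG₂mono, hG₂eq⟩ := exists_monotone_map_compProd_unitSquare μ₁ κ₂ hκ₂
  obtain ⟨G₃, hG₃m, hG₃mono, hG₃eq⟩ := exists_monotone_map_compProd hG₂m hG₂mono κ₃ hκ₃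
  exact ⟨G₃, hG₃m, hG₃mono, by rw [hG₃eq, hG₂eq]⟩

/-- **CIS laws in dimension three, given the first open layer of the continuous case**: if `LiebSahiContinuum 3 n`
holds then `E_n(f_0,…,f_{n−1}) ≥ 0` under `(μ₁ ⊗ₘ κ₂) ⊗ₘ κ₃` (stochastically increasing kernels as above) for all
nonnegative monotone increasing measurable `f_i : [0,1]² × [0,1] → ℝ`. [this work] -/
theorem msahiE_compProd_compProd_nonneg_of_liebSahiContinuum_three {n : ℕ} (h : LiebSahiContinuum 3 n)
    (μ₁ : Measure I) [IsProbabilityMeasure μ₁] (κ₂ : Kernel I I) [IsMarkovKernel κ₂]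
    (hκ₂ : ∀ ⦃a b : I⦄, a ≤ b → ∀ x : I, κ₂ b (Set.Iic x) ≤ κ₂ a (Set.Iic x))
    (κ₃ : Kernel (I × I) I) [IsMarkovKernel κ₃]
    (hκ₃ : ∀ ⦃p q : I × I⦄, p ≤ q → ∀ x : I, κ₃ q (Set.Iic x) ≤ κ₃ p (Set.Iic x))
    (f : Fin n → (I × I) × I → ℝ) (hfm : ∀ i, Measurable (f i)) (hf0 : ∀ i p, 0 ≤ f i p)
    (hmono : ∀ i, Monotone (f i)) : 0 ≤ msahiE ((μ₁ ⊗ₘ κ₂) ⊗ₘ κ₃) n f := by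
  obtain ⟨G', hG'm, hG'mono, hG'eq⟩ := exists_monotone_map_compProd_compProd μ₁ κ₂ hκ₂ κ₃ hκ₃
  rw [← hG'eq]
  exact msahiE_map_nonneg_of_liebSahiContinuum h hG'm hG'mono f hfm hf0 hmono

/-- The same for DECREASING measurable families. [this work] -/
theorem msahiE_compProd_compProd_nonneg_of_liebSahiContinuum_three_antitone {n : ℕ} (h : LiebSahiContinuum 3 n)
    (μ₁ : Measure I) [IsProbabilityMeasure μ₁] (κ₂ : Kernel I I) [IsMarkovKernel κ₂]
    (hκ₂ : ∀ ⦃a b : I⦄, a ≤ b → ∀ x : I, κ₂ b (Set.Iic x) ≤ κ₂ a (Set.Iic x))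
    (κ₃ : Kernel (I × I) I) [IsMarkovKernel κ₃]
    (hκ₃ : ∀ ⦃p q : I × I⦄, p ≤ q → ∀ x : I, κ₃ q (Set.Iic x) ≤ κ₃ p (Set.Iic x))
    (f : Fin n → (I × I) × I → ℝ) (hfm : ∀ i, Measurable (f i)) (hf0 : ∀ i p, 0 ≤ f i p)
    (hanti : ∀ i, Antitone (f i)) : 0 ≤ msahiE ((μ₁ ⊗ₘ κ₂) ⊗ₘ κ₃) n f := by
  obtain ⟨G', hG'm, hG'mono, hG'eq⟩ := exists_monotone_map_compProd_compProd μ₁ κ₂ hκ₂ κ₃ hκ₃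
  rw [← hG'eq]
  exact msahiE_map_nonneg_of_liebSahiContinuum_antitone h hG'm hG'mono f hfm hf0 hanti

end Summit.CriticalPhenomena.PercolationContinuityZ3.Theorems
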